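import Mathlib.Analysis.Complex.AbsMax
import Mathlib.Analysis.Normed.Module.RCLike.Real
import HarnessLib

/-!
# Roy's small value estimate for `𝔾ₐ × 𝔾ₘ` — a product lemma for linear forms on a torus

Topic `Literature/NumberTheory/Transcendental`. Part of the formalisation of the proof of Roy 2013,
Theorem 1.1 (named fact `roy2013_thm_1_1`, `RoySmallValueEstimates.lean`), seat B (an
elimination-free reorganisation of §§2, 5–6 of D. Roy, *A small value estimate for `𝔾ₐ × 𝔾ₘ`*,
Mathematika 59 (2013) 333–363 = arXiv:1301.0663). Roy's §2 imports from Laurent–Roy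
(J. reine angew. Math. 536 (2001), Prop. 3.7 (i)) the comparison between the height of a product
of linear forms relative to a convex body and the sum of the heights of the factors
(used in Prop. 2.3 and, through Prop. 2.2 (iii), in Prop. 6.2 of the paper). In this development
that comparison is replaced by the following elementary MAXIMUM-MODULUS statement, which is all that
is needed downstream (selection of a Galois orbit in §6, and the archimedean half of the
Gelfond–Mahler inequality for products of linear forms):

* `exists_circle_prod_affine_ge` — for finitely many affine functions `αⱼ w + βⱼ` on `ℂ`,
  exponents `eⱼ` and a radius `r > 0`, some `w` with `|w| = r` has
  `∏ⱼ max(r|αⱼ|, |βⱼ|)^{eⱼ} ≤ ∏ⱼ |αⱼ w + βⱼ|^{eⱼ}` (Jensen / Mahler-measure inequality for a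
  product of linear factors, proved by replacing each factor with a root inside the circle by the
  Blaschke-reflected factor of the same modulus on the circle and applying the maximum modulus
  principle at the centre);
* `exists_torus_prod_linear_ge` — for finitely many linear forms `Lⱼ(z) = ∑ᵢ aⱼᵢ zᵢ` on `ℂ^ι`,
  exponents `eⱼ`, any assignment `j ↦ i₀(j)` of a distinguished coefficient, and `r > 0`, some
  point `z` of the torus `|zᵢ| = r` has `∏ⱼ (r |a_{j,i₀(j)}|)^{eⱼ} ≤ ∏ⱼ |Lⱼ(z)|^{eⱼ}`
  (induction on the number of variables).

Everything here is proved; no definitions, no named facts.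

## References

* [Roy2013] D. Roy, *A small value estimate for 𝔾ₐ × 𝔾ₘ*, Mathematika 59 (2013), 333–363
  (arXiv:1301.0663), §2, Prop. 2.3 and its proof (the appeal to [LR, Prop. 3.7 (i)]).
* [LaurentRoy2001] M. Laurent, D. Roy, *Criteria of algebraic independence with multiplicities
  and approximation by hypersurfaces*, J. reine angew. Math. 536 (2001), 65–114, Prop. 3.7 (i).
-/

noncomputable section

open Finset Complex Metric

namespace Literature.NumberTheory.Transcendental

namespace Roy2013

universe u

/-! ### One variable: Blaschke reflection and the maximum modulus principle -/

/-- **Jensen–Mahler inequality for a product of linear factors, maximum-modulus form.** For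
finitely many affine functions `αⱼ w + βⱼ`, exponents `eⱼ` and `r > 0` there is `w` on the circle
`|w| = r` with `∏ⱼ max(r|αⱼ|, |βⱼ|)^{eⱼ} ≤ ∏ⱼ |αⱼ w + βⱼ|^{eⱼ}`. Proof: each factor `α w + β` whose
root lies inside the circle (`|β| < r|α|`) is replaced by the reflected factor
`α (r² + conj(β/α) w) / r`, which has the same modulus on `|w| = r` and modulus `r|α|` at `w = 0`;
the maximum modulus principle for the resulting polynomial on the disc `|w| ≤ r` gives the claim.
[folklore] -/
theorem exists_circle_prod_affine_ge {J : Type u} [Fintype J] (α β : J → ℂ) (e : J → ℕ)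
    {r : ℝ} (hr : 0 < r) :
    ∃ w : ℂ, ‖w‖ = r ∧ ∏ j, (max (r * ‖α j‖) ‖β j‖) ^ e j ≤ ∏ j, ‖α j * w + β j‖ ^ e j := by
  -- the modified factors
  let g : J → ℂ → ℂ := fun j w =>
    if ‖β j‖ < r * ‖α j‖ then α j * ((r : ℂ) ^ 2 + (starRingEnd ℂ) (β j / α j) * w) / r
    else α j * w + β j
  have hgd : ∀ j, Differentiable ℂ (g j) := by
    intro j
    by_cases h : ‖β j‖ < r * ‖α j‖
    · have : g j = fun w => α j * ((r : ℂ) ^ 2 + (starRingEnd ℂ) (β j / α j) * w) / r := by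
        funext w; exact if_pos h
      rw [this]
      exact ((differentiable_const _).mul
        ((differentiable_const _).add ((differentiable_const _).mul differentiable_id))).div_const _
    · have : g j = fun w => α j * w + β j := by funext w; exact if_neg h
      rw [this]
      exact ((differentiable_const _).mul differentiable_id).add (differentiable_const _)
  -- modulus at the centre
  have hg0 : ∀ j, ‖g j 0‖ = max (r * ‖α j‖) ‖β j‖ := by
    intro j
    by_cases h : ‖β j‖ < r * ‖α j‖
    · rw [show g j 0 = α j * ((r : ℂ) ^ 2 + (starRingEnd ℂ) (β j / α j) * 0) / r from if_pos h,
        max_eq_left h.le, mul_zero, add_zero, norm_div, norm_mul, norm_pow, Complex.norm_real,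
        Real.norm_eq_abs, abs_of_pos hr]
      field_simp
    · rw [show g j 0 = α j * 0 + β j from if_neg h, mul_zero, zero_add, max_eq_right (not_lt.mp h)]
  -- modulus on the circle
  have hgc : ∀ j {w : ℂ}, ‖w‖ = r → ‖g j w‖ = ‖α j * w + β j‖ := by
    intro j w hw
    by_cases h : ‖β j‖ < r * ‖α j‖
    · have hα : α j ≠ 0 := by
        intro h0
        rw [h0, norm_zero, mul_zero] at h
        exact (norm_nonneg (β j)).not_gt h
      -- `r² = w · conj w`, so `r² + conj(β/α) w = w · conj(w + β/α)`
      have hr2 : ((r : ℂ) ^ 2) = w * (starRingEnd ℂ) w := by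
        rw [Complex.mul_conj, Complex.normSq_eq_norm_sq, hw]; push_cast; ring
      have key : (r : ℂ) ^ 2 + (starRingEnd ℂ) (β j / α j) * w =
          w * (starRingEnd ℂ) (w + β j / α j) := by
        rw [hr2, map_add]; ring
      rw [show g j w = α j * ((r : ℂ) ^ 2 + (starRingEnd ℂ) (β j / α j) * w) / r from if_pos h,
        key, norm_div, norm_mul, norm_mul, Complex.norm_conj, hw, Complex.norm_real,
        Real.norm_eq_abs, abs_of_pos hr]
      have : α j * w + β j = α j * (w + β j / α j) := by field_simp
      rw [this, norm_mul]
      field_simp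
    · exact congrArg _ (if_neg h)
  -- maximum modulus principle for `G = ∏ gⱼ^{eⱼ}` on the disc `|w| < r`
  set G : ℂ → ℂ := fun w => ∏ j, g j w ^ e j with hG
  have hGd : Differentiable ℂ G := by
    rw [hG]
    exact Differentiable.fun_finsetProd fun j _ => (hgd j).pow (e j)
  obtain ⟨z, hz, hmax⟩ := Complex.exists_mem_frontier_isMaxOn_norm (isBounded_ball (x := (0 : ℂ))
    (r := r)) ⟨0, mem_ball_self hr⟩ hGd.diffContOnCl
  rw [frontier_ball (0 : ℂ) hr.ne', mem_sphere_zero_iff_norm] at hz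
  refine ⟨z, hz, ?_⟩
  have h0 : ‖G 0‖ ≤ ‖G z‖ := hmax (subset_closure (mem_ball_self hr))
  have hG0 : ‖G 0‖ = ∏ j, (max (r * ‖α j‖) ‖β j‖) ^ e j := by
    rw [hG]; simp only [norm_prod, norm_pow, hg0]
  have hGz : ‖G z‖ = ∏ j, ‖α j * z + β j‖ ^ e j := by
    rw [hG]; simp only [norm_prod, norm_pow, hgc _ hz]
  rwa [hG0, hGz] at h0

/-! ### Several variables: a large value on a torus -/

/-- The torus lemma for `k` variables (induction on `k`). [folklore] -/
theorem exists_torus_prod_linear_ge_fin (k : ℕ) :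
    ∀ {J : Type u} [Fintype J] (a : J → Fin k → ℂ) (e : J → ℕ) (i₀ : J → Fin k) {r : ℝ},
      0 < r → ∃ z : Fin k → ℂ, (∀ i, ‖z i‖ = r) ∧
        ∏ j, (r * ‖a j (i₀ j)‖) ^ e j ≤ ∏ j, ‖∑ i, a j i * z i‖ ^ e j := by
  induction k with
  | zero =>
    intro J _ a e i₀ r hr
    refine ⟨Fin.elim0, fun i => i.elim0, ?_⟩
    have : IsEmpty J := ⟨fun j => (i₀ j).elim0⟩
    simp
  | succ k ih =>
    intro J _ a e i₀ r hr
    classical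
    -- the factors whose distinguished index is not `0`, handled by induction on the last `k` variables
    let J' := {j : J // i₀ j ≠ 0}
    obtain ⟨z', hz', hprod'⟩ := ih (J := J') (fun j i => a j.1 i.succ) (fun j => e j.1)
      (fun j => (i₀ j.1).pred j.2) hr
    -- the remaining variable
    set L' : J → ℂ := fun j => ∑ i, a j (Fin.succ i) * z' i with hL'
    obtain ⟨w, hw, hcirc⟩ := exists_circle_prod_affine_ge (fun j => a j 0) L' e hr
    refine ⟨Fin.cons w z', Fin.cases (by simpa using hw) (fun i => by simpa using hz' i), ?_⟩
    have hsum : ∀ j, ∑ i, a j i * (Fin.cons w z' : Fin (k + 1) → ℂ) i = a j 0 * w + L' j := by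
      intro j
      rw [Fin.sum_univ_succ]
      simp [hL']
    simp_rw [hsum]
    refine le_trans ?_ hcirc
    -- split the left product according to whether `i₀ j = 0`
    rw [← Fintype.prod_subtype_mul_prod_subtype (fun j => i₀ j = 0)
      (fun j => (r * ‖a j (i₀ j)‖) ^ e j),
      ← Fintype.prod_subtype_mul_prod_subtype (fun j => i₀ j = 0)
      (fun j => (max (r * ‖a j 0‖) ‖L' j‖) ^ e j)]
    refine mul_le_mul ?_ ?_ (prod_nonneg fun j _ => by positivity)
      (prod_nonneg fun j _ => by positivity)
    · refine prod_le_prod (fun j _ => by positivity) fun j _ => ?_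
      rw [j.2]
      exact pow_le_pow_left₀ (by positivity) (le_max_left _ _) _
    · calc ∏ j : {j : J // ¬i₀ j = 0}, (r * ‖a j (i₀ j)‖) ^ e j
          ≤ ∏ j : J', ‖∑ i, a j.1 (Fin.succ i) * z' i‖ ^ e j.1 := by
            convert hprod' using 2 with j
            rw [Fin.succ_pred]
        _ ≤ ∏ j : {j : J // ¬i₀ j = 0}, (max (r * ‖a j 0‖) ‖L' j‖) ^ e j :=
            prod_le_prod (fun j _ => by positivity) fun j _ =>
              pow_le_pow_left₀ (norm_nonneg _) (le_max_right _ _) _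

/-- **Product lemma on a torus.** Let `Lⱼ(z) = ∑ᵢ aⱼᵢ zᵢ` (`j ∈ J`) be finitely many linear forms
on `ℂ^ι` (`ι` finite), `eⱼ ∈ ℕ`, `i₀ : J → ι` any assignment of a distinguished coefficient, and
`r > 0`. Then some point `z` of the torus `|zᵢ| = r` (all `i`) satisfies
`∏ⱼ (r |a_{j, i₀(j)}|)^{eⱼ} ≤ ∏ⱼ |Lⱼ(z)|^{eⱼ}`. (With `i₀(j)` a largest coefficient of `Lⱼ` this
is the inequality `∏ M(Lⱼ)^{eⱼ} = M(∏ Lⱼ^{eⱼ}) ≤ sup_{torus} |∏ Lⱼ^{eⱼ}|` of Mahler measures.)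
It replaces, in this development, the appeal of Roy 2013, Prop. 2.3 to Laurent–Roy 2001,
Prop. 3.7 (i). [folklore] -/
theorem exists_torus_prod_linear_ge {ι : Type*} {J : Type u} [Fintype ι] [Fintype J]
    (a : J → ι → ℂ) (e : J → ℕ) (i₀ : J → ι) {r : ℝ} (hr : 0 < r) :
    ∃ z : ι → ℂ, (∀ i, ‖z i‖ = r) ∧
      ∏ j, (r * ‖a j (i₀ j)‖) ^ e j ≤ ∏ j, ‖∑ i, a j i * z i‖ ^ e j := by
  classical
  set σ := Fintype.equivFin ι
  obtain ⟨z, hz, hprod⟩ := exists_torus_prod_linear_ge_fin (Fintype.card ι)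
    (fun j i => a j (σ.symm i)) e (fun j => σ (i₀ j)) hr
  refine ⟨fun i => z (σ i), fun i => hz _, ?_⟩
  have h1 : ∀ j, a j (σ.symm (σ (i₀ j))) = a j (i₀ j) := fun j => by rw [σ.symm_apply_apply]
  have h2 : ∀ j, ∑ i, a j i * z (σ i) = ∑ i, a j (σ.symm i) * z i := fun j =>
    Fintype.sum_equiv σ _ _ fun i => by rw [σ.symm_apply_apply]
  simp_rw [h1] at hprod
  simp_rw [h2]
  exact hprod

end Roy2013

end Literature.NumberTheory.Transcendental
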